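import Summits.NavierStokesRegularity.FluidComputer.PalasekTowerRadialChildRelaxation
import Summits.NavierStokesRegularity.FluidComputer.PalasekTowerBurgersNumber
import Mathlib.Analysis.Real.Pi.Bounds
import Mathlib.Analysis.Complex.ExponentialBounds

/-!
# REGISTER v2.3″ (continued): the RADIAL child's window band in register units — the «Burgers
# number» thresholds of the floor and of the ceiling after the relaxation clock, and the certified
# two-sided band `P ∈ [20.6, 25.8]` under `Schedule.Rigid`

Cell `ns-blowup`, seat `ns-blowup-ecbridge-8` (g8); evidence toward crux 19250 `HeredityFromTwo` (UPPER
half `stub_window_ceiling` and floor `stub_speed_floors`) of route `PalasekTowerBreakdown`, MODEL lane,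
RADIAL class («child core = radial cross-section carried by the host strain `λA_k` at `ν = 1`», the
exact strained eddy MB (2.71); `PalasekTowerRadialChildRelaxation`, ecbridge-8 g7). That file certifies,
after the relaxation clock `λA_k t ≥ log(1 + λA_kN₂/(2εN₁))`, the max swirl of ANY radial seed in
`[((1 − e^{−1}) − ε)/(4π), max(1/(4√2π) + mε/(8π), 1/(2πm))]·Γ(λA_k/ν_t)^{1/2}` (co-signed seed,
`ν_t = 1 − e^{−λA_k t}`). Here the two ends are read in the units of `PalasekTowerBurgersNumber`
(circulation on the core-ledger scale `Γ ≶ C·N_{k+1}^{β−2}`, Burgers number `P := C√λ·N_k^{β/2−b}`,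
`N_{k+1}^{β−2}(A_k)^{1/2} = N_k^{β/2−b}·Y_{k+1}` = `_burgers_scaling`), as `_burgers_floor` /
`_burgers_noOvershoot` read the Burgers child and `PalasekTowerLundgrenChildWindowBand` any profile:

* `palasekTowerBreakdown_radialChild_floor_threshold` — co-signed even seed, `Γ ≥ C·N_{k+1}^{β−2}`,
  `ε ≤ 1 − e^{−1}`, clock delivered: **`4πc₁ ≤ ((1 − e^{−1}) − ε)·P` ⇒ the swirl speed at the radius
  `r₀ = 2(ν_t/λA_k)^{1/2}` is `≥ c₁Y_{k+1}`** (exact threshold `P ≥ 4πc₁/((1 − e^{−1}) − ε)`,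
  `= 20.53·c₁` at `ε = 1/50`); `…_floor_threshold_fiftieth`: `ε = 1/50`, `C ≥ 0`, **`P ≥ 20.6·c₁`**
  suffices (`Real.pi_lt_d6`, `Real.exp_neg_one_lt_d9`);
* `palasekTowerBreakdown_radialChild_noOvershoot` — co-signed radial seed, `Γ ≤ C·N_{k+1}^{β−2}`,
  clock delivered and `λA_k t ≥ s > 0`: **`max(1/(4√2π) + mε/(8π), 1/(2πm))·P ≤ c₂(1 − e^{−s})^{1/2}`
  ⇒ `|v^θ(r, t)| ≤ c₂Y_{k+1}` at EVERY radius**; numeric instances at `m = 8`, `ε = 1/50`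
  (`max ≤ 0.0627`): `…_noOvershoot_after_one_strain_time` (`s = 1`: **`0.0789·P ≤ c₂`** suffices;
  exact `0.0788`), `…_noOvershoot_after_three_strain_times` (`s = 3`: **`0.0644·P ≤ c₂`**; exact
  `0.0643`; the `s → ∞` value is `0.0626`, i.e. `P ≤ 26.6` at `c₂ = 5/3`);
* **`palasekTowerBreakdown_radialChild_band_rigid`** — `Schedule.Rigid` (`c₁ = 1`, `c₂ = 5/3`),
  co-signed radial seed with `Γ = C·N_{k+1}^{β−2}`, `C ≥ 0`, clock at `ε = 1/50` delivered and
  `λA_k t ≥ 3`: **`P ∈ [20.6, 25.8]` ⇒ the floor `c₁Y_{k+1}` is met (at `r₀`) AND no point overshoots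
  `c₂Y_{k+1}`** — a certified two-sided band of ratio `25.8/20.6 = 1.252 < 5/3` for EVERY radial seed
  profile (Burgers child: `[19.9, 29.6]`, `PalasekTowerBurgersNumber`; any-profile class: certified
  regions DISJOINT, `PalasekTowerLundgrenChildWindowBand`).

Reading (numbers): certified radial band after one strain time past the clock `[20.6, 21.1]`, after
three `[20.6, 25.8]`, late limit `[20.53, 26.6]`. WHAT THIS IS NOT: not NS about any registered flow —
exact INFINITE-ENERGY strained eddies (MB Ex. 2.9) under a MODEL identification; nothing is asserted
about `WindowCeilingAt`, `AprioriCeiling`, `ReadoutFloors` or any crux; non-radial seeds (Gallay–Wayne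
2005) not covered; the band is a statement about g7's certified BOUNDS, not a sharp constant.

References: Majda–Bertozzi, CUP 2002, §2.3.3 Ex. 2.9 [cite: MajdaBertozziCUP2002, §2.3.3 Example 2.9
eqs. (2.71)–(2.72)]; Saffman, *Vortex Dynamics*, CUP 1992, §13.1 (4), §13.3 (12) [cite: Saffman1992,
§13.3 eq. (12)]; S. Palasek, arXiv:2605.13827, §3 (3.2), §3.3 [cite: Palasek2026ElementaryModel, §3 (3.2)].
-/

namespace Summit.NavierStokesRegularity.FluidComputer.PalasekTowerClayBridge

open Real Set MeasureTheory
open Literature.Analysis.FluidPDE Literature.Analysis.FluidPDE.RadialEddy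

variable {ω₀ : EuclideanSpace ℝ (Fin 2) → ℝ}

/-! ### §0 Numerics -/
/-- `79/125 ≤ 1 − e^{−1}` (`e > 2.7182818283`). [folklore] -/
private theorem one_sub_exp_neg_one_ge : (79 : ℝ) / 125 ≤ 1 - exp (-1) := by
  have he := Real.exp_one_gt_d9
  have hpos := Real.exp_pos (1 : ℝ)
  rw [Real.exp_neg]
  have : (exp 1)⁻¹ ≤ 46 / 125 := by
    rw [inv_le_comm₀ hpos (by norm_num)]
    linarith
  linarith

/-- `0.795 < (1 − e^{−1})^{1/2}` (`0.795² = 0.632025 < 1 − 0.3678794412`). [folklore] -/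
private theorem sqrt_one_sub_exp_neg_one_gt : 0.795 < Real.sqrt (1 - exp (-1)) := by
  have he : exp (-1) < 0.3678794412 := exp_neg_one_lt_d9
  rw [Real.lt_sqrt (by norm_num)]
  norm_num at he ⊢
  linarith

/-- `0.9747 < (1 − e^{−3})^{1/2}` (`e^{−3} = (e^{−1})³ < 0.04979`, `0.9747² < 0.95021`). [folklore] -/
private theorem sqrt_one_sub_exp_neg_three_gt : 0.9747 < Real.sqrt (1 - exp (-3)) := by
  have he : exp (-1) < 0.3678794412 := exp_neg_one_lt_d9
  have he3 : exp (-3) = exp (-1) ^ 3 := by rw [← Real.exp_nat_mul]; norm_num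
  have hcube : exp (-1) ^ 3 < 0.3678794412 ^ 3 := pow_lt_pow_left₀ he (exp_pos _).le (by norm_num)
  rw [Real.lt_sqrt (by norm_num), he3]
  norm_num at hcube ⊢
  linarith

/-- `1/(4√2π) < 0.0563` (`√2 > 1.41421`, `π > 3.141592`). [folklore] -/
private theorem inv_four_sqrt_two_pi_lt : 1 / (4 * Real.sqrt 2 * π) < 0.0563 := by
  have hπ : 3.141592 < π := pi_gt_d6
  have h2 : 1.41421 < Real.sqrt 2 := by rw [Real.lt_sqrt (by norm_num)]; norm_num
  have hpos : 0 < 4 * Real.sqrt 2 * π := by positivity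
  rw [div_lt_iff₀ hpos]
  nlinarith [mul_pos (sub_pos.2 h2) (sub_pos.2 hπ)]

/-- The ceiling constant at `m = 8`, `ε = 1/50`: `max(1/(4√2π) + 8·(1/50)/(8π), 1/(2π·8)) ≤ 0.0627`
(`= 0.05627 + 0.00637 ⊔ 0.0199`). [folklore] -/
private theorem ceilingConst_eight_fiftieth_le :
    max (1 / (4 * Real.sqrt 2 * π) + 8 * (1 / 50) / (8 * π)) (1 / (2 * π * 8)) ≤ 0.0627 := by
  have hπ : 3.141592 < π := pi_gt_d6
  have hπ0 : 0 < π := pi_pos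
  have h1 := inv_four_sqrt_two_pi_lt
  have h2 : 8 * (1 / 50) / (8 * π) ≤ 0.0064 := by rw [div_le_iff₀ (by positivity)]; nlinarith
  have h3 : 1 / (2 * π * 8) ≤ 0.0627 := by rw [div_le_iff₀ (by positivity)]; nlinarith
  refine max_le ?_ h3
  linarith

/-! ### §1 The floor threshold -/

/-- **THE RADIAL CHILD'S FLOOR IN BURGERS-NUMBER UNITS** (`ν = 1`, host strain `λA_k`; co-signed
even seed `ω₀ ≥ 0` — every radial seed is even, `RadialEddy.eq_of_radial_neg` — with `Γ = ∫ω₀ > 0`,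
finite second moment, tolerance `0 < ε ≤ 1 − e^{−1}`, the relaxation clock
`λA_k t ≥ log(1 + λA_kN₂/(2εN₁))` delivered at `t > 0`; circulation on the core-ledger scale
`Γ ≥ C·N_{k+1}^{β−2}`, `P := C√λ·N_k^{β/2−b}`): **if `4πc₁ ≤ ((1 − e^{−1}) − ε)·P` then the child's
swirl speed at the radius `r₀ = 2(ν_t/λA_k)^{1/2}` is at least `c₁Y_{k+1}`** — from g7's floor
`((1 − e^{−1})Γ − εN₁)/(4π)·(λA_k/ν_t)^{1/2}` (`_radialChild_maxSwirl_floor`), `ν_t ≤ 1` and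
`_burgers_scaling`. Exact threshold `P ≥ 4πc₁/((1 − e^{−1}) − ε)` (`20.53·c₁` at `ε = 1/50`; Burgers
child `19.9·c₁`, any profile `25.13ρ^{1/2}·c₁`). -/
theorem palasekTowerBreakdown_radialChild_floor_threshold (R : TowerRates) (k : ℕ) {l : ℝ}
    (hl : 0 < l) (hω₀ : Integrable ω₀) (h2 : Integrable fun y => ‖y‖ ^ 2 * |ω₀ y|)
    (heven : ∀ y, ω₀ (-y) = ω₀ y) (hnn : ∀ y, 0 ≤ ω₀ y) (hN : 0 < ∫ y, ω₀ y) {ε : ℝ} (hε : 0 < ε)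
    (hε1 : ε ≤ 1 - exp (-1)) {t : ℝ} (ht : 0 < t)
    (hclock : Real.log (1 + l * R.A k * (∫ y, ‖y‖ ^ 2 * |ω₀ y|) / (2 * ε * ∫ y, |ω₀ y|)) ≤
      l * R.A k * t)
    {C c₁ : ℝ} (hCΓ : C * R.N (k + 1) ^ (R.β - 2) ≤ ∫ y, ω₀ y)
    (hP : 4 * π * c₁ ≤ (1 - exp (-1) - ε) * (C * Real.sqrt l * R.N k ^ (R.β / 2 - R.b))) :
    c₁ * R.Y (k + 1) ≤
      2 * Real.sqrt ((1 - exp (-(l * R.A k * t))) / (l * R.A k)) *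
        vorticityToSwirl (rayProfile (strainedEddyVorticity (l * R.A k) 1 ω₀ t))
          ((2 * Real.sqrt ((1 - exp (-(l * R.A k * t))) / (l * R.A k))) ^ 2) := by
  have hγ : 0 < l * R.A k := mul_pos hl (R.A_pos k)
  have hY : 0 < R.Y (k + 1) := Real.rpow_pos_of_pos (R.N_pos _) _
  have hπ : 0 < π := pi_pos
  have hN₁ : (∫ y, |ω₀ y|) = ∫ y, ω₀ y :=
    integral_congr_ae (Filter.Eventually.of_forall fun y => abs_of_nonneg (hnn y))
  have hN' : 0 < ∫ y, |ω₀ y| := by rw [hN₁]; exact hN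
  have hfloor := palasekTowerBreakdown_radialChild_maxSwirl_floor R k hl hω₀ h2 heven hN' hε ht hclock
  rw [hN₁] at hfloor
  refine le_trans ?_ hfloor
  set Γ : ℝ := ∫ y, ω₀ y with hΓ
  set νt : ℝ := 1 - exp (-(l * R.A k * t)) with hνt
  have hνt0 : 0 < νt := by
    have : exp (-(l * R.A k * t)) < 1 := exp_lt_one_iff.2 (by nlinarith [mul_pos hγ ht])
    simp only [hνt]; linarith
  have hνt1 : νt ≤ 1 := by
    have := exp_pos (-(l * R.A k * t))
    simp only [hνt]; linarith
  have hfac : 0 ≤ 1 - exp (-1) - ε := by linarith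
  have hsqrt_le : Real.sqrt (l * R.A k) ≤ Real.sqrt (l * R.A k / νt) :=
    Real.sqrt_le_sqrt (le_div_self hγ.le hνt0 hνt1)
  have hscale := palasekTowerBreakdown_burgers_scaling R k
  have hlA : 0 ≤ Real.sqrt l * Real.sqrt (R.A k) := by positivity
  -- `4π c₁ Y ≤ ((1 − e^{−1}) − ε)·P·Y = ((1 − e^{−1}) − ε)·C N_{k+1}^{β−2}·√λ√A_k ≤ ((1 − e^{−1}) − ε)·Γ·√(λA_k)`
  have h1 : 4 * π * c₁ * R.Y (k + 1) ≤
      (1 - exp (-1) - ε) * (C * Real.sqrt l * R.N k ^ (R.β / 2 - R.b)) * R.Y (k + 1) :=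
    mul_le_mul_of_nonneg_right hP hY.le
  have h2' : (1 - exp (-1) - ε) * (C * Real.sqrt l * R.N k ^ (R.β / 2 - R.b)) * R.Y (k + 1) =
      (1 - exp (-1) - ε) * (C * R.N (k + 1) ^ (R.β - 2)) * (Real.sqrt l * Real.sqrt (R.A k)) := by
    rw [show (1 - exp (-1) - ε) * (C * Real.sqrt l * R.N k ^ (R.β / 2 - R.b)) * R.Y (k + 1) =
      (1 - exp (-1) - ε) * C * Real.sqrt l * (R.N k ^ (R.β / 2 - R.b) * R.Y (k + 1)) by ring, ← hscale]
    ring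
  have h3 : (1 - exp (-1) - ε) * (C * R.N (k + 1) ^ (R.β - 2)) * (Real.sqrt l * Real.sqrt (R.A k)) ≤
      (1 - exp (-1) - ε) * Γ * (Real.sqrt l * Real.sqrt (R.A k)) :=
    mul_le_mul_of_nonneg_right (mul_le_mul_of_nonneg_left hCΓ hfac) hlA
  have h4π : 0 < 4 * π := by positivity
  calc c₁ * R.Y (k + 1) = 4 * π * c₁ * R.Y (k + 1) / (4 * π) := by
        field_simp
    _ ≤ (1 - exp (-1) - ε) * Γ * (Real.sqrt l * Real.sqrt (R.A k)) / (4 * π) :=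
        div_le_div_of_nonneg_right (by linarith [h1, h2', h3]) h4π.le
    _ = ((1 - exp (-1)) * Γ - ε * Γ) / (4 * π) * Real.sqrt (l * R.A k) := by
        rw [Real.sqrt_mul hl.le]; ring
    _ ≤ ((1 - exp (-1)) * Γ - ε * Γ) / (4 * π) * Real.sqrt (l * R.A k / νt) :=
        mul_le_mul_of_nonneg_left hsqrt_le
          (div_nonneg (by nlinarith [mul_nonneg hfac hN.le]) h4π.le)

/-- **THE RADIAL FLOOR AT `ε = 1/50`: `P ≥ 20.6·c₁` SUFFICES** (setting of
`_radialChild_floor_threshold` with the clock at `ε = 1/50` and `C ≥ 0`): the swirl speed at `r₀` is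
`≥ c₁Y_{k+1}` — `4π/20.6 = 0.6100 ≤ 0.612 ≤ 0.98 − e^{−1} = 0.6121`. Burgers child: `19.9·c₁`
(`_burgers_floor`). -/
theorem palasekTowerBreakdown_radialChild_floor_threshold_fiftieth (R : TowerRates) (k : ℕ) {l : ℝ}
    (hl : 0 < l) (hω₀ : Integrable ω₀) (h2 : Integrable fun y => ‖y‖ ^ 2 * |ω₀ y|)
    (heven : ∀ y, ω₀ (-y) = ω₀ y) (hnn : ∀ y, 0 ≤ ω₀ y) (hN : 0 < ∫ y, ω₀ y) {t : ℝ} (ht : 0 < t)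
    (hclock : Real.log (1 + l * R.A k * (∫ y, ‖y‖ ^ 2 * |ω₀ y|) / (2 * (1 / 50) * ∫ y, |ω₀ y|)) ≤
      l * R.A k * t)
    {C c₁ : ℝ} (hC : 0 ≤ C) (hCΓ : C * R.N (k + 1) ^ (R.β - 2) ≤ ∫ y, ω₀ y)
    (hP : 20.6 * c₁ ≤ C * Real.sqrt l * R.N k ^ (R.β / 2 - R.b)) :
    c₁ * R.Y (k + 1) ≤
      2 * Real.sqrt ((1 - exp (-(l * R.A k * t))) / (l * R.A k)) *
        vorticityToSwirl (rayProfile (strainedEddyVorticity (l * R.A k) 1 ω₀ t))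
          ((2 * Real.sqrt ((1 - exp (-(l * R.A k * t))) / (l * R.A k))) ^ 2) := by
  have hπ : π < 3.141593 := pi_lt_d6
  have hπ0 : 0 < π := pi_pos
  have he : exp (-1) < 0.3678794412 := exp_neg_one_lt_d9
  have he' := one_sub_exp_neg_one_ge
  have hPnn : 0 ≤ C * Real.sqrt l * R.N k ^ (R.β / 2 - R.b) :=
    mul_nonneg (mul_nonneg hC (Real.sqrt_nonneg _)) (Real.rpow_pos_of_pos (R.N_pos k) _).le
  refine palasekTowerBreakdown_radialChild_floor_threshold R k hl hω₀ h2 heven hnn hN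
    (by norm_num : (0 : ℝ) < 1 / 50) (by linarith) ht hclock hCΓ ?_
  have h1 : 4 * π * c₁ ≤ 4 * π / 20.6 * (C * Real.sqrt l * R.N k ^ (R.β / 2 - R.b)) := by
    calc 4 * π * c₁ = 4 * π / 20.6 * (20.6 * c₁) := by ring
      _ ≤ 4 * π / 20.6 * (C * Real.sqrt l * R.N k ^ (R.β / 2 - R.b)) :=
          mul_le_mul_of_nonneg_left hP (by positivity)
  have h2' : 4 * π / 20.6 ≤ 1 - exp (-1) - 1 / 50 := by
    rw [div_le_iff₀ (by norm_num)]
    norm_num at he ⊢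
    linarith
  exact h1.trans (mul_le_mul_of_nonneg_right h2' hPnn)

/-! ### §2 The no-overshoot threshold -/

/-- **THE RADIAL CHILD'S CEILING IN BURGERS-NUMBER UNITS** (`ν = 1`, host strain `λA_k`; co-signed
RADIAL seed `ω₀ ≥ 0`, `Γ = ∫ω₀ > 0`, finite second moment, relaxation clock at tolerance `ε > 0`
delivered at `t > 0`, splitting parameter `m > 0`, and `λA_k t ≥ s > 0`; circulation
`Γ ≤ C·N_{k+1}^{β−2}`, `P := C√λ·N_k^{β/2−b}`): **if
`max(1/(4√2π) + mε/(8π), 1/(2πm))·P ≤ c₂·(1 − e^{−s})^{1/2}` then `|v^θ(r, t)| ≤ c₂Y_{k+1}` at every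
radius `r ≥ 0`** — g7's ceiling `max(…)·Γ(λA_k/ν_t)^{1/2}` (`_radialChild_maxSwirl_ceiling`),
`ν_t ≥ 1 − e^{−s}`, and `_burgers_scaling`. Compare `_burgers_noOvershoot` (`P ≤ 4√2π·c₂`) and
`_anyProfile_noOvershoot_late` (`0.3556·P ≤ c₂`). -/
theorem palasekTowerBreakdown_radialChild_noOvershoot (R : TowerRates) (k : ℕ) {l : ℝ}
    (hl : 0 < l) (hω₀ : Integrable ω₀) (h2 : Integrable fun y => ‖y‖ ^ 2 * |ω₀ y|)
    (hrad : ∀ (U : EuclideanSpace ℝ (Fin 2) ≃ₗᵢ[ℝ] EuclideanSpace ℝ (Fin 2))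
      (y : EuclideanSpace ℝ (Fin 2)), ω₀ (U y) = ω₀ y)
    (hnn : ∀ y, 0 ≤ ω₀ y) (hN : 0 < ∫ y, ω₀ y) {ε : ℝ} (hε : 0 < ε) {t : ℝ} (ht : 0 < t)
    (hclock : Real.log (1 + l * R.A k * (∫ y, ‖y‖ ^ 2 * |ω₀ y|) / (2 * ε * ∫ y, |ω₀ y|)) ≤
      l * R.A k * t)
    {m : ℝ} (hm : 0 < m) {s : ℝ} (hs : 0 < s) (hst : s ≤ l * R.A k * t)
    {C c₂ : ℝ} (hΓC : (∫ y, ω₀ y) ≤ C * R.N (k + 1) ^ (R.β - 2))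
    (hP : max (1 / (4 * Real.sqrt 2 * π) + m * ε / (8 * π)) (1 / (2 * π * m)) *
        (C * Real.sqrt l * R.N k ^ (R.β / 2 - R.b)) ≤ c₂ * Real.sqrt (1 - exp (-s)))
    {r : ℝ} (hr : 0 ≤ r) :
    |r * vorticityToSwirl (rayProfile (strainedEddyVorticity (l * R.A k) 1 ω₀ t)) (r ^ 2)| ≤
      c₂ * R.Y (k + 1) := by
  have hγ : 0 < l * R.A k := mul_pos hl (R.A_pos k)
  have hY : 0 < R.Y (k + 1) := Real.rpow_pos_of_pos (R.N_pos _) _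
  have hπ : 0 < π := pi_pos
  have hN₁ : (∫ y, |ω₀ y|) = ∫ y, ω₀ y :=
    integral_congr_ae (Filter.Eventually.of_forall fun y => abs_of_nonneg (hnn y))
  have hN' : 0 < ∫ y, |ω₀ y| := by rw [hN₁]; exact hN
  have hceil := palasekTowerBreakdown_radialChild_maxSwirl_ceiling R k hl hω₀ h2 hrad hN' hε ht hclock
    hm hr
  rw [hN₁, abs_of_pos hN] at hceil
  refine hceil.trans ?_
  set Γ : ℝ := ∫ y, ω₀ y with hΓ
  set νt : ℝ := 1 - exp (-(l * R.A k * t)) with hνt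
  set M : ℝ := max (1 / (4 * Real.sqrt 2 * π) + m * ε / (8 * π)) (1 / (2 * π * m)) with hM
  have hM0 : 0 < M := lt_max_of_lt_right (by positivity)
  have hνt0 : 0 < νt := by
    have : exp (-(l * R.A k * t)) < 1 := exp_lt_one_iff.2 (by nlinarith [mul_pos hγ ht])
    simp only [hνt]; linarith
  have hνs : 1 - exp (-s) ≤ νt := by
    have : exp (-(l * R.A k * t)) ≤ exp (-s) := exp_le_exp.2 (by linarith)
    simp only [hνt]; linarith
  -- the sign of `C` and `c₂`
  have hC : 0 < C := by
    by_contra hC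
    have : C * R.N (k + 1) ^ (R.β - 2) ≤ 0 :=
      mul_nonpos_of_nonpos_of_nonneg (not_lt.1 hC) (Real.rpow_pos_of_pos (R.N_pos _) _).le
    linarith
  have hP0 : 0 < C * Real.sqrt l * R.N k ^ (R.β / 2 - R.b) :=
    mul_pos (mul_pos hC (Real.sqrt_pos.2 hl)) (Real.rpow_pos_of_pos (R.N_pos k) _)
  have hc₂ : 0 ≤ c₂ := by
    by_contra hc
    have : c₂ * Real.sqrt (1 - exp (-s)) ≤ 0 :=
      mul_nonpos_of_nonpos_of_nonneg (not_le.1 hc).le (Real.sqrt_nonneg _)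
    nlinarith [mul_pos hM0 hP0]
  have hmax : max (Γ / (4 * Real.sqrt 2 * π) + m * ε * Γ / (8 * π)) (Γ / (2 * π * m)) = M * Γ := by
    rw [hM, max_mul_of_nonneg _ _ hN.le]
    congr 1 <;> ring
  have hsA : Real.sqrt (l * R.A k / νt) = Real.sqrt l * Real.sqrt (R.A k) / Real.sqrt νt := by
    rw [Real.sqrt_div' _ hνt0.le, Real.sqrt_mul hl.le]
  have hscale := palasekTowerBreakdown_burgers_scaling R k
  have hsν : 0 < Real.sqrt νt := Real.sqrt_pos.2 hνt0
  rw [hmax]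
  calc M * Γ * Real.sqrt (l * R.A k / νt)
      ≤ M * (C * R.N (k + 1) ^ (R.β - 2)) * Real.sqrt (l * R.A k / νt) :=
        mul_le_mul_of_nonneg_right (mul_le_mul_of_nonneg_left hΓC hM0.le) (Real.sqrt_nonneg _)
    _ = M * C * Real.sqrt l * (R.N (k + 1) ^ (R.β - 2) * Real.sqrt (R.A k)) / Real.sqrt νt := by
        rw [hsA]; ring
    _ = M * (C * Real.sqrt l * R.N k ^ (R.β / 2 - R.b)) * R.Y (k + 1) / Real.sqrt νt := by
        rw [hscale]; ring
    _ ≤ c₂ * Real.sqrt (1 - exp (-s)) * R.Y (k + 1) / Real.sqrt νt :=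
        div_le_div_of_nonneg_right (mul_le_mul_of_nonneg_right hP hY.le) hsν.le
    _ ≤ c₂ * R.Y (k + 1) := by
        rw [div_le_iff₀ hsν]
        calc c₂ * Real.sqrt (1 - exp (-s)) * R.Y (k + 1)
            = c₂ * R.Y (k + 1) * Real.sqrt (1 - exp (-s)) := by ring
          _ ≤ c₂ * R.Y (k + 1) * Real.sqrt νt :=
              mul_le_mul_of_nonneg_left (Real.sqrt_le_sqrt hνs) (mul_nonneg hc₂ hY.le)

/-- **NO OVERSHOOT AFTER ONE STRAIN TIME PAST THE CLOCK: `0.0789·P ≤ c₂` SUFFICES** (setting of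
`_radialChild_noOvershoot` at `m = 8`, `ε = 1/50`, `s = 1`): every radius has `|v^θ(r, t)| ≤ c₂Y_{k+1}`
once `λA_k t ≥ 1` — ceiling constant `max(1/(4√2π) + 1/(50π), 1/(16π)) ≤ 0.0627`, time factor
`(1 − e^{−1})^{1/2} > 0.795` (exact threshold `0.0788·P ≤ c₂`; at `c₂ = 5/3`, `P ≤ 21.1`). -/
theorem palasekTowerBreakdown_radialChild_noOvershoot_after_one_strain_time (R : TowerRates) (k : ℕ)
    {l : ℝ} (hl : 0 < l) (hω₀ : Integrable ω₀) (h2 : Integrable fun y => ‖y‖ ^ 2 * |ω₀ y|)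
    (hrad : ∀ (U : EuclideanSpace ℝ (Fin 2) ≃ₗᵢ[ℝ] EuclideanSpace ℝ (Fin 2))
      (y : EuclideanSpace ℝ (Fin 2)), ω₀ (U y) = ω₀ y)
    (hnn : ∀ y, 0 ≤ ω₀ y) (hN : 0 < ∫ y, ω₀ y) {t : ℝ} (ht : 0 < t)
    (hclock : Real.log (1 + l * R.A k * (∫ y, ‖y‖ ^ 2 * |ω₀ y|) / (2 * (1 / 50) * ∫ y, |ω₀ y|)) ≤
      l * R.A k * t)
    (h1 : 1 ≤ l * R.A k * t) {C c₂ : ℝ} (hΓC : (∫ y, ω₀ y) ≤ C * R.N (k + 1) ^ (R.β - 2))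
    (hP : 0.0789 * (C * Real.sqrt l * R.N k ^ (R.β / 2 - R.b)) ≤ c₂) {r : ℝ} (hr : 0 ≤ r) :
    |r * vorticityToSwirl (rayProfile (strainedEddyVorticity (l * R.A k) 1 ω₀ t)) (r ^ 2)| ≤
      c₂ * R.Y (k + 1) := by
  have hC : 0 < C := by
    by_contra hC
    have : C * R.N (k + 1) ^ (R.β - 2) ≤ 0 :=
      mul_nonpos_of_nonpos_of_nonneg (not_lt.1 hC) (Real.rpow_pos_of_pos (R.N_pos _) _).le
    linarith
  have hP0 : 0 < C * Real.sqrt l * R.N k ^ (R.β / 2 - R.b) :=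
    mul_pos (mul_pos hC (Real.sqrt_pos.2 hl)) (Real.rpow_pos_of_pos (R.N_pos k) _)
  have hc₂ : 0 ≤ c₂ := by nlinarith
  have hM := ceilingConst_eight_fiftieth_le
  have hsq := sqrt_one_sub_exp_neg_one_gt
  refine palasekTowerBreakdown_radialChild_noOvershoot R k hl hω₀ h2 hrad hnn hN
    (by norm_num : (0 : ℝ) < 1 / 50) ht hclock (by norm_num : (0 : ℝ) < 8) one_pos h1 hΓC ?_ hr
  calc max (1 / (4 * Real.sqrt 2 * π) + 8 * (1 / 50) / (8 * π)) (1 / (2 * π * 8)) *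
        (C * Real.sqrt l * R.N k ^ (R.β / 2 - R.b))
      ≤ 0.0627 * (C * Real.sqrt l * R.N k ^ (R.β / 2 - R.b)) := mul_le_mul_of_nonneg_right hM hP0.le
    _ ≤ c₂ * 0.795 := by
        norm_num at hP ⊢
        nlinarith
    _ ≤ c₂ * Real.sqrt (1 - exp (-1)) := mul_le_mul_of_nonneg_left hsq.le hc₂

/-- **NO OVERSHOOT AFTER THREE STRAIN TIMES PAST THE CLOCK: `0.0644·P ≤ c₂` SUFFICES** (same setting,
`s = 3`): time factor `(1 − e^{−3})^{1/2} > 0.9747` (exact threshold `0.0643·P ≤ c₂`; at `c₂ = 5/3`,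
`P ≤ 25.9`; the late limit `s → ∞` is `0.0626·P ≤ c₂`, `P ≤ 26.6`). -/
theorem palasekTowerBreakdown_radialChild_noOvershoot_after_three_strain_times (R : TowerRates)
    (k : ℕ) {l : ℝ} (hl : 0 < l) (hω₀ : Integrable ω₀) (h2 : Integrable fun y => ‖y‖ ^ 2 * |ω₀ y|)
    (hrad : ∀ (U : EuclideanSpace ℝ (Fin 2) ≃ₗᵢ[ℝ] EuclideanSpace ℝ (Fin 2))
      (y : EuclideanSpace ℝ (Fin 2)), ω₀ (U y) = ω₀ y)
    (hnn : ∀ y, 0 ≤ ω₀ y) (hN : 0 < ∫ y, ω₀ y) {t : ℝ} (ht : 0 < t)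
    (hclock : Real.log (1 + l * R.A k * (∫ y, ‖y‖ ^ 2 * |ω₀ y|) / (2 * (1 / 50) * ∫ y, |ω₀ y|)) ≤
      l * R.A k * t)
    (h3 : 3 ≤ l * R.A k * t) {C c₂ : ℝ} (hΓC : (∫ y, ω₀ y) ≤ C * R.N (k + 1) ^ (R.β - 2))
    (hP : 0.0644 * (C * Real.sqrt l * R.N k ^ (R.β / 2 - R.b)) ≤ c₂) {r : ℝ} (hr : 0 ≤ r) :
    |r * vorticityToSwirl (rayProfile (strainedEddyVorticity (l * R.A k) 1 ω₀ t)) (r ^ 2)| ≤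
      c₂ * R.Y (k + 1) := by
  have hC : 0 < C := by
    by_contra hC
    have : C * R.N (k + 1) ^ (R.β - 2) ≤ 0 :=
      mul_nonpos_of_nonpos_of_nonneg (not_lt.1 hC) (Real.rpow_pos_of_pos (R.N_pos _) _).le
    linarith
  have hP0 : 0 < C * Real.sqrt l * R.N k ^ (R.β / 2 - R.b) :=
    mul_pos (mul_pos hC (Real.sqrt_pos.2 hl)) (Real.rpow_pos_of_pos (R.N_pos k) _)
  have hc₂ : 0 ≤ c₂ := by nlinarith
  have hM := ceilingConst_eight_fiftieth_le
  have hsq := sqrt_one_sub_exp_neg_three_gt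
  refine palasekTowerBreakdown_radialChild_noOvershoot R k hl hω₀ h2 hrad hnn hN
    (by norm_num : (0 : ℝ) < 1 / 50) ht hclock (by norm_num : (0 : ℝ) < 8) (by norm_num : (0 : ℝ) < 3)
    h3 hΓC ?_ hr
  calc max (1 / (4 * Real.sqrt 2 * π) + 8 * (1 / 50) / (8 * π)) (1 / (2 * π * 8)) *
        (C * Real.sqrt l * R.N k ^ (R.β / 2 - R.b))
      ≤ 0.0627 * (C * Real.sqrt l * R.N k ^ (R.β / 2 - R.b)) := mul_le_mul_of_nonneg_right hM hP0.le
    _ ≤ c₂ * 0.9747 := by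
        norm_num at hP ⊢
        nlinarith
    _ ≤ c₂ * Real.sqrt (1 - exp (-3)) := mul_le_mul_of_nonneg_left hsq.le hc₂

/-! ### §3 The certified two-sided band under `Schedule.Rigid` -/

/-- **THE RADIAL CHILD PASSES THE REGISTER'S TWO-SIDED WINDOW TEST ON THE BAND `P ∈ [20.6, 25.8]`**
(`Schedule.Rigid`: `c₁ = 1`, `c₂ = 5/3`; `ν = 1`, host strain `λA_k`; co-signed RADIAL seed with
circulation exactly on the core-ledger scale, `∫ω₀ = C·N_{k+1}^{β−2} > 0` with `C ≥ 0`, finite second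
moment; the relaxation clock at `ε = 1/50` delivered and `λA_k t ≥ 3`): if the Burgers number
`P = C√λ·N_k^{β/2−b}` lies in `[20.6, 25.8]`, then the swirl speed at `r₀ = 2(ν_t/λA_k)^{1/2}` is
`≥ c₁Y_{k+1}` AND `|v^θ(r, t)| ≤ c₂Y_{k+1}` at every radius — a certified band of ratio `1.252 < 5/3`
for EVERY radial seed profile (Burgers child `[19.9, 29.6]`; ANY-profile class: no band,
`_anyProfile_thresholds_disjoint`). -/
theorem palasekTowerBreakdown_radialChild_band_rigid (R : TowerRates) (Sch : Schedule R)
    (hS : Sch.Rigid) (k : ℕ) {l : ℝ} (hl : 0 < l) (hω₀ : Integrable ω₀)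
    (h2 : Integrable fun y => ‖y‖ ^ 2 * |ω₀ y|)
    (hrad : ∀ (U : EuclideanSpace ℝ (Fin 2) ≃ₗᵢ[ℝ] EuclideanSpace ℝ (Fin 2))
      (y : EuclideanSpace ℝ (Fin 2)), ω₀ (U y) = ω₀ y)
    (hnn : ∀ y, 0 ≤ ω₀ y) (hN : 0 < ∫ y, ω₀ y) {t : ℝ} (ht : 0 < t)
    (hclock : Real.log (1 + l * R.A k * (∫ y, ‖y‖ ^ 2 * |ω₀ y|) / (2 * (1 / 50) * ∫ y, |ω₀ y|)) ≤
      l * R.A k * t)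
    (h3 : 3 ≤ l * R.A k * t) {C : ℝ} (hC : 0 ≤ C) (hΓ : (∫ y, ω₀ y) = C * R.N (k + 1) ^ (R.β - 2))
    (hPl : 20.6 ≤ C * Real.sqrt l * R.N k ^ (R.β / 2 - R.b))
    (hPu : C * Real.sqrt l * R.N k ^ (R.β / 2 - R.b) ≤ 25.8) :
    Sch.c₁ * R.Y (k + 1) ≤
        2 * Real.sqrt ((1 - exp (-(l * R.A k * t))) / (l * R.A k)) *
          vorticityToSwirl (rayProfile (strainedEddyVorticity (l * R.A k) 1 ω₀ t))
            ((2 * Real.sqrt ((1 - exp (-(l * R.A k * t))) / (l * R.A k))) ^ 2) ∧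
      ∀ r : ℝ, 0 ≤ r →
        |r * vorticityToSwirl (rayProfile (strainedEddyVorticity (l * R.A k) 1 ω₀ t)) (r ^ 2)| ≤
          Sch.c₂ * R.Y (k + 1) := by
  have heven : ∀ y, ω₀ (-y) = ω₀ y := eq_of_radial_neg hrad
  refine ⟨?_, fun r hr => ?_⟩
  · refine palasekTowerBreakdown_radialChild_floor_threshold_fiftieth R k hl hω₀ h2 heven hnn hN ht
      hclock hC hΓ.symm.le ?_
    rw [hS.c₁_eq, mul_one]
    exact hPl
  · refine palasekTowerBreakdown_radialChild_noOvershoot_after_three_strain_times R k hl hω₀ h2 hrad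
      hnn hN ht hclock h3 hΓ.le ?_ hr
    rw [hS.c₂_eq]
    norm_num at hPu ⊢
    linarith

end Summit.NavierStokesRegularity.FluidComputer.PalasekTowerClayBridge
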